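import Mathlib.Analysis.InnerProductSpace.Calculus
import Mathlib.Analysis.Calculus.Deriv.Star
import Mathlib.Analysis.Calculus.Deriv.Inv
import Mathlib.Analysis.Calculus.Deriv.MeanValue
import Mathlib.Analysis.Convex.Deriv
import Mathlib.Analysis.Convex.Jensen
import HarnessLib

/-!
# A priori amplitude bounds for `u″ + φ u = 0` without asymptotics:
# the Sonin–Pólya energy, the envelope, and convexity of `|u|²` in a forbidden region

Topic `Literature/Analysis/ODE` (namespace `Literature.Analysis.ODE`). Three folklore tools that
bound COMPLEX solutions of the real one-dimensional Schrödinger / Sturm–Liouville equation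
`u″ = −φ(x) u` (`φ` real, `C¹`) pointwise, with constants that depend only on the monotonicity of
`φ` — no large-parameter (WKB / Liouville–Green) expansion and no error-control function:

* **Sonin–Pólya energy** `E = φ|u|² + |u′|²`: `E′ = φ′|u|²` (`hasDerivAt_soninEnergy`), so `E` is
  non-increasing where `φ` is non-increasing and non-decreasing where `φ` is non-decreasing
  (`soninEnergy_antitoneOn`, `soninEnergy_monotoneOn`); in particular, moving in the direction in
  which `φ` DEcreases, `|u′|² ≤ E(x₀)` and `φ|u|² ≤ E(x₀)` (`WKB`-type growth `|u| ≲ φ^{-1/2}`);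
* **the envelope** `N = |u|² + |u′|²/φ` (`φ > 0`): `N′ = −φ′|u′|²/φ²` (`hasDerivAt_soninEnvelope`),
  so `N` is non-increasing where `φ` is non-decreasing (Sonin's theorem: the successive maxima of
  `|u|` decrease in the direction of increasing `φ` — G. Szegő, *Orthogonal Polynomials*, Thm 7.31.1)
  and non-decreasing where `φ` is non-increasing (`soninEnvelope_antitoneOn`, `…_monotoneOn`);
* **forbidden regions** `u″ = q u` with `q ≥ 0`: `(|u|²)″ = 2|u′|² + 2q|u|² ≥ 0`, so `|u|²` is convex
  (`convexOn_norm_sq_of_nonneg`), bounded by its values at the ends of the region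
  (`norm_sq_le_max_of_nonneg`), and non-decreasing as soon as `Re(ū u′) ≥ 0` at the left end
  (`monotoneOn_norm_sq_of_nonneg`).

Hypotheses are pointwise `HasDerivAt` statements on a closed interval `[α, β]` for `u, u′ : ℝ → ℂ`
(and `φ, φ′ : ℝ → ℝ`), the form in which classical solutions on an open set are available; `ℂ` is
used as a REAL inner-product space (`⟪z, w⟫ = Re(w z̄)`, `Complex.inner`, notation of `RealInnerProductSpace`). Everything is proved.

Used toward the cone Green-kernel bound of the near-extremal Kerr programme
(`Summits/FinalStateConjecture/…/Cruxes/KappaExplicitWaveDecay`, stub `stub_coneKernelNonSuperradiant`: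
polynomial a priori bounds for the horizon / infinity solutions of Carter's radial ODE in the two
classically allowed regions and in the single barrier).

## References
* G. Szegő, *Orthogonal Polynomials*, AMS Colloquium Publ. 23, 4th ed. (1975), §7.31,
  Theorem 7.31.1 (Sonin–Pólya) and footnote (Butlewski's form for `(k u′)′ + φ u = 0`).
* F. W. J. Olver, *Asymptotics and Special Functions* (1974), Ch. 6 §1 (the exponential /
  oscillatory dichotomy that these elementary bounds replace when only polynomial constants matter).
-/

noncomputable section

open Set Filter Topology
open scoped ComplexConjugate RealInnerProductSpace

namespace Literature.Analysis.ODE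

/-! ### The real inner product on `ℂ` against `u″ = c·u` with real `c` -/

/-- `⟪u′, c u⟫ = c ⟪u, u′⟫` for real `c`. [folklore] -/
theorem real_inner_mul_real_right (u v : ℂ) (c : ℝ) : ⟪v, (c : ℂ) * u⟫ = c * ⟪u, v⟫ := by
  rw [Complex.inner, Complex.inner]
  simp only [Complex.mul_re, Complex.mul_im, Complex.conj_re, Complex.conj_im, Complex.ofReal_re,
    Complex.ofReal_im]
  ring

/-- `⟪u, u⟫ = |u|²` on `ℂ`. [folklore] -/
theorem real_inner_self_eq_norm_sq' (u : ℂ) : ⟪u, u⟫ = ‖u‖ ^ 2 :=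
  real_inner_self_eq_norm_sq u

/-! ### The Sonin–Pólya energy `E = φ|u|² + |u′|²` -/

/-- **`E′ = φ′|u|²`**: along a solution of `u″ = −φ u` (at a point where `u`, `u′`, `φ` have the
stated derivatives) the energy `φ|u|² + |u′|²` has derivative `φ′|u|²`. [folklore] -/
theorem hasDerivAt_soninEnergy {u u' : ℝ → ℂ} {φ : ℝ → ℝ} {φ' : ℝ} {x : ℝ}
    (hu : HasDerivAt u (u' x) x) (hu' : HasDerivAt u' (-(φ x : ℂ) * u x) x)
    (hφ : HasDerivAt φ φ' x) :
    HasDerivAt (fun y => φ y * ‖u y‖ ^ 2 + ‖u' y‖ ^ 2) (φ' * ‖u x‖ ^ 2) x := by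
  have h1 : HasDerivAt (fun y => ‖u y‖ ^ 2) (2 * ⟪u x, u' x⟫) x := hu.norm_sq
  have h2 : HasDerivAt (fun y => ‖u' y‖ ^ 2) (2 * ⟪u' x, -(φ x : ℂ) * u x⟫) x := hu'.norm_sq
  have h := (hφ.mul h1).add h2
  refine h.congr_deriv ?_
  have e : -(φ x : ℂ) * u x = ((-φ x : ℝ) : ℂ) * u x := by push_cast; ring
  rw [e, real_inner_mul_real_right]
  ring

/-- **Sonin–Pólya, decreasing `φ`**: if on `[α, β]` the solution data and `φ′ ≤ 0` hold pointwise,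
then `E = φ|u|² + |u′|²` is non-increasing on `[α, β]`. [folklore] -/
theorem soninEnergy_antitoneOn {u u' : ℝ → ℂ} {φ φ' : ℝ → ℝ} {α β : ℝ}
    (h : ∀ x ∈ Icc α β, HasDerivAt u (u' x) x ∧ HasDerivAt u' (-(φ x : ℂ) * u x) x ∧
      HasDerivAt φ (φ' x) x)
    (hφ' : ∀ x ∈ Icc α β, φ' x ≤ 0) : AntitoneOn (fun y => φ y * ‖u y‖ ^ 2 + ‖u' y‖ ^ 2) (Icc α β) := by
  have hd : ∀ x ∈ Icc α β, HasDerivAt (fun y => φ y * ‖u y‖ ^ 2 + ‖u' y‖ ^ 2) (φ' x * ‖u x‖ ^ 2) x :=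
    fun x hx => hasDerivAt_soninEnergy (h x hx).1 (h x hx).2.1 (h x hx).2.2
  refine antitoneOn_of_deriv_nonpos (convex_Icc α β)
    (fun x hx => (hd x hx).continuousAt.continuousWithinAt)
    (fun x hx => (hd x (interior_subset hx)).differentiableAt.differentiableWithinAt) ?_
  intro x hx
  rw [(hd x (interior_subset hx)).deriv]
  exact mul_nonpos_of_nonpos_of_nonneg (hφ' x (interior_subset hx)) (sq_nonneg _)

/-- **Sonin–Pólya, increasing `φ`**: if `φ′ ≥ 0` on `[α, β]` then `E = φ|u|² + |u′|²` is
non-decreasing on `[α, β]`. [folklore] -/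
theorem soninEnergy_monotoneOn {u u' : ℝ → ℂ} {φ φ' : ℝ → ℝ} {α β : ℝ}
    (h : ∀ x ∈ Icc α β, HasDerivAt u (u' x) x ∧ HasDerivAt u' (-(φ x : ℂ) * u x) x ∧
      HasDerivAt φ (φ' x) x)
    (hφ' : ∀ x ∈ Icc α β, 0 ≤ φ' x) : MonotoneOn (fun y => φ y * ‖u y‖ ^ 2 + ‖u' y‖ ^ 2) (Icc α β) := by
  have hd : ∀ x ∈ Icc α β, HasDerivAt (fun y => φ y * ‖u y‖ ^ 2 + ‖u' y‖ ^ 2) (φ' x * ‖u x‖ ^ 2) x :=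
    fun x hx => hasDerivAt_soninEnergy (h x hx).1 (h x hx).2.1 (h x hx).2.2
  refine monotoneOn_of_deriv_nonneg (convex_Icc α β)
    (fun x hx => (hd x hx).continuousAt.continuousWithinAt)
    (fun x hx => (hd x (interior_subset hx)).differentiableAt.differentiableWithinAt) ?_
  intro x hx
  rw [(hd x (interior_subset hx)).deriv]
  exact mul_nonneg (hφ' x (interior_subset hx)) (sq_nonneg _)

/-- **A priori bound in the direction of decreasing `φ`** (pointwise form): with `φ′ ≤ 0` on
`[α, β]` and `α ≤ x ≤ y ≤ β`, `φ(y)|u(y)|² + |u′(y)|² ≤ φ(x)|u(x)|² + |u′(x)|²`; in particular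
`|u′(y)|² ≤ E(x)` and, where `φ(y) > 0`, `|u(y)|² ≤ E(x)/φ(y)`. [folklore] -/
theorem soninEnergy_le_of_le {u u' : ℝ → ℂ} {φ φ' : ℝ → ℝ} {α β x y : ℝ}
    (h : ∀ x ∈ Icc α β, HasDerivAt u (u' x) x ∧ HasDerivAt u' (-(φ x : ℂ) * u x) x ∧
      HasDerivAt φ (φ' x) x)
    (hφ' : ∀ x ∈ Icc α β, φ' x ≤ 0) (hx : x ∈ Icc α β) (hy : y ∈ Icc α β) (hxy : x ≤ y) :
    φ y * ‖u y‖ ^ 2 + ‖u' y‖ ^ 2 ≤ φ x * ‖u x‖ ^ 2 + ‖u' x‖ ^ 2 :=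
  soninEnergy_antitoneOn h hφ' hx hy hxy

/-- Same, in the direction of increasing `φ` read backwards: with `φ′ ≥ 0` on `[α, β]` and
`α ≤ x ≤ y ≤ β`, `φ(x)|u(x)|² + |u′(x)|² ≤ φ(y)|u(y)|² + |u′(y)|²`. [folklore] -/
theorem soninEnergy_le_of_ge {u u' : ℝ → ℂ} {φ φ' : ℝ → ℝ} {α β x y : ℝ}
    (h : ∀ x ∈ Icc α β, HasDerivAt u (u' x) x ∧ HasDerivAt u' (-(φ x : ℂ) * u x) x ∧
      HasDerivAt φ (φ' x) x)
    (hφ' : ∀ x ∈ Icc α β, 0 ≤ φ' x) (hx : x ∈ Icc α β) (hy : y ∈ Icc α β) (hxy : x ≤ y) :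
    φ x * ‖u x‖ ^ 2 + ‖u' x‖ ^ 2 ≤ φ y * ‖u y‖ ^ 2 + ‖u' y‖ ^ 2 :=
  soninEnergy_monotoneOn h hφ' hx hy hxy

/-! ### The Sonin envelope `N = |u|² + |u′|²/φ` (`φ > 0`) -/

/-- **`N′ = −φ′|u′|²/φ²`** along a solution of `u″ = −φu` at a point with `φ(x) ≠ 0`. [folklore] -/
theorem hasDerivAt_soninEnvelope {u u' : ℝ → ℂ} {φ : ℝ → ℝ} {φ' : ℝ} {x : ℝ}
    (hu : HasDerivAt u (u' x) x) (hu' : HasDerivAt u' (-(φ x : ℂ) * u x) x)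
    (hφ : HasDerivAt φ φ' x) (hφ0 : φ x ≠ 0) :
    HasDerivAt (fun y => ‖u y‖ ^ 2 + ‖u' y‖ ^ 2 / φ y) (-(φ' * ‖u' x‖ ^ 2) / φ x ^ 2) x := by
  have h1 : HasDerivAt (fun y => ‖u y‖ ^ 2) (2 * ⟪u x, u' x⟫) x := hu.norm_sq
  have h2 : HasDerivAt (fun y => ‖u' y‖ ^ 2) (2 * ⟪u' x, -(φ x : ℂ) * u x⟫) x := hu'.norm_sq
  have h := h1.add (h2.div hφ hφ0)
  refine h.congr_deriv ?_
  have e : -(φ x : ℂ) * u x = ((-φ x : ℝ) : ℂ) * u x := by push_cast; ring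
  rw [e, real_inner_mul_real_right]
  field_simp
  ring

/-- **Sonin's theorem, increasing `φ`**: if `φ > 0` and `φ′ ≥ 0` on `[α, β]` then the envelope
`|u|² + |u′|²/φ` is non-increasing on `[α, β]` (so the local maxima of `|u|` decrease in the
direction of increasing `φ`). [folklore] -/
theorem soninEnvelope_antitoneOn {u u' : ℝ → ℂ} {φ φ' : ℝ → ℝ} {α β : ℝ}
    (h : ∀ x ∈ Icc α β, HasDerivAt u (u' x) x ∧ HasDerivAt u' (-(φ x : ℂ) * u x) x ∧
      HasDerivAt φ (φ' x) x)
    (hφ : ∀ x ∈ Icc α β, 0 < φ x) (hφ' : ∀ x ∈ Icc α β, 0 ≤ φ' x) :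
    AntitoneOn (fun y => ‖u y‖ ^ 2 + ‖u' y‖ ^ 2 / φ y) (Icc α β) := by
  have hd : ∀ x ∈ Icc α β,
      HasDerivAt (fun y => ‖u y‖ ^ 2 + ‖u' y‖ ^ 2 / φ y) (-(φ' x * ‖u' x‖ ^ 2) / φ x ^ 2) x :=
    fun x hx => hasDerivAt_soninEnvelope (h x hx).1 (h x hx).2.1 (h x hx).2.2 (hφ x hx).ne'
  refine antitoneOn_of_deriv_nonpos (convex_Icc α β)
    (fun x hx => (hd x hx).continuousAt.continuousWithinAt)
    (fun x hx => (hd x (interior_subset hx)).differentiableAt.differentiableWithinAt) ?_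
  intro x hx
  rw [(hd x (interior_subset hx)).deriv]
  have : 0 ≤ φ' x * ‖u' x‖ ^ 2 := mul_nonneg (hφ' x (interior_subset hx)) (sq_nonneg _)
  exact div_nonpos_of_nonpos_of_nonneg (neg_nonpos.2 this) (sq_nonneg _)

/-- **Sonin's theorem, decreasing `φ`**: if `φ > 0` and `φ′ ≤ 0` on `[α, β]` then the envelope
`|u|² + |u′|²/φ` is non-decreasing on `[α, β]`. [folklore] -/
theorem soninEnvelope_monotoneOn {u u' : ℝ → ℂ} {φ φ' : ℝ → ℝ} {α β : ℝ}
    (h : ∀ x ∈ Icc α β, HasDerivAt u (u' x) x ∧ HasDerivAt u' (-(φ x : ℂ) * u x) x ∧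
      HasDerivAt φ (φ' x) x)
    (hφ : ∀ x ∈ Icc α β, 0 < φ x) (hφ' : ∀ x ∈ Icc α β, φ' x ≤ 0) :
    MonotoneOn (fun y => ‖u y‖ ^ 2 + ‖u' y‖ ^ 2 / φ y) (Icc α β) := by
  have hd : ∀ x ∈ Icc α β,
      HasDerivAt (fun y => ‖u y‖ ^ 2 + ‖u' y‖ ^ 2 / φ y) (-(φ' x * ‖u' x‖ ^ 2) / φ x ^ 2) x :=
    fun x hx => hasDerivAt_soninEnvelope (h x hx).1 (h x hx).2.1 (h x hx).2.2 (hφ x hx).ne'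
  refine monotoneOn_of_deriv_nonneg (convex_Icc α β)
    (fun x hx => (hd x hx).continuousAt.continuousWithinAt)
    (fun x hx => (hd x (interior_subset hx)).differentiableAt.differentiableWithinAt) ?_
  intro x hx
  rw [(hd x (interior_subset hx)).deriv]
  have : φ' x * ‖u' x‖ ^ 2 ≤ 0 :=
    mul_nonpos_of_nonpos_of_nonneg (hφ' x (interior_subset hx)) (sq_nonneg _)
  exact div_nonneg (neg_nonneg.2 this) (sq_nonneg _)

/-- **Amplitude bound in the direction of increasing `φ`** (pointwise form of Sonin's theorem):
with `φ > 0`, `φ′ ≥ 0` on `[α, β]` and `α ≤ x ≤ y ≤ β`,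
`|u(y)|² ≤ |u(y)|² + |u′(y)|²/φ(y) ≤ |u(x)|² + |u′(x)|²/φ(x)`. [folklore] -/
theorem norm_sq_le_soninEnvelope_of_le {u u' : ℝ → ℂ} {φ φ' : ℝ → ℝ} {α β x y : ℝ}
    (h : ∀ x ∈ Icc α β, HasDerivAt u (u' x) x ∧ HasDerivAt u' (-(φ x : ℂ) * u x) x ∧
      HasDerivAt φ (φ' x) x)
    (hφ : ∀ x ∈ Icc α β, 0 < φ x) (hφ' : ∀ x ∈ Icc α β, 0 ≤ φ' x) (hx : x ∈ Icc α β)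
    (hy : y ∈ Icc α β) (hxy : x ≤ y) :
    ‖u y‖ ^ 2 ≤ ‖u x‖ ^ 2 + ‖u' x‖ ^ 2 / φ x := by
  have h1 : ‖u y‖ ^ 2 + ‖u' y‖ ^ 2 / φ y ≤ ‖u x‖ ^ 2 + ‖u' x‖ ^ 2 / φ x :=
    soninEnvelope_antitoneOn h hφ hφ' hx hy hxy
  have h2 : ‖u y‖ ^ 2 ≤ ‖u y‖ ^ 2 + ‖u' y‖ ^ 2 / φ y :=
    le_add_of_nonneg_right (div_nonneg (sq_nonneg _) (hφ y hy).le)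
  exact h2.trans h1

/-- **Amplitude bound in the direction of decreasing `φ`**: with `φ > 0`, `φ′ ≤ 0` on `[α, β]` and
`α ≤ x ≤ y ≤ β`, `|u(x)|² ≤ |u(y)|² + |u′(y)|²/φ(y)`. [folklore] -/
theorem norm_sq_le_soninEnvelope_of_ge {u u' : ℝ → ℂ} {φ φ' : ℝ → ℝ} {α β x y : ℝ}
    (h : ∀ x ∈ Icc α β, HasDerivAt u (u' x) x ∧ HasDerivAt u' (-(φ x : ℂ) * u x) x ∧
      HasDerivAt φ (φ' x) x)
    (hφ : ∀ x ∈ Icc α β, 0 < φ x) (hφ' : ∀ x ∈ Icc α β, φ' x ≤ 0) (hx : x ∈ Icc α β)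
    (hy : y ∈ Icc α β) (hxy : x ≤ y) :
    ‖u x‖ ^ 2 ≤ ‖u y‖ ^ 2 + ‖u' y‖ ^ 2 / φ y := by
  have h1 : ‖u x‖ ^ 2 + ‖u' x‖ ^ 2 / φ x ≤ ‖u y‖ ^ 2 + ‖u' y‖ ^ 2 / φ y :=
    soninEnvelope_monotoneOn h hφ hφ' hx hy hxy
  have h2 : ‖u x‖ ^ 2 ≤ ‖u x‖ ^ 2 + ‖u' x‖ ^ 2 / φ x :=
    le_add_of_nonneg_right (div_nonneg (sq_nonneg _) (hφ x hx).le)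
  exact h2.trans h1

/-! ### Forbidden regions: `u″ = q u` with `q ≥ 0` makes `|u|²` convex -/

/-- `(|u|²)′ = 2⟪u, u′⟫ = 2 Re(ū u′)`. [folklore] -/
theorem hasDerivAt_norm_sq_complex {u u' : ℝ → ℂ} {x : ℝ} (hu : HasDerivAt u (u' x) x) :
    HasDerivAt (fun y => ‖u y‖ ^ 2) (2 * (conj (u x) * u' x).re) x := by
  have h := hu.norm_sq
  rw [Complex.inner, mul_comm (u' x)] at h
  exact h

/-- `(2 Re(ū u′))′ = 2|u′|² + 2q|u|²` along `u″ = q u` (`q` real). [folklore] -/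
theorem hasDerivAt_two_re_conj_mul {u u' : ℝ → ℂ} {q : ℝ → ℝ} {x : ℝ}
    (hu : HasDerivAt u (u' x) x) (hu' : HasDerivAt u' ((q x : ℂ) * u x) x) :
    HasDerivAt (fun y => 2 * (conj (u y) * u' y).re) (2 * ‖u' x‖ ^ 2 + 2 * q x * ‖u x‖ ^ 2) x := by
  have hc : HasDerivAt (fun y => conj (u y)) (conj (u' x)) x := hu.star
  have hprod : HasDerivAt (fun y => conj (u y) * u' y) (conj (u' x) * u' x + conj (u x) * ((q x : ℂ) * u x)) x :=
    hc.mul hu'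
  have hre : HasDerivAt (fun y => (conj (u y) * u' y).re)
      ((conj (u' x) * u' x + conj (u x) * ((q x : ℂ) * u x)).re) x :=
    Complex.reCLM.hasFDerivAt.comp_hasDerivAt x hprod
  refine (hre.const_mul 2).congr_deriv ?_
  rw [Complex.add_re]
  have e1 : (conj (u' x) * u' x).re = ‖u' x‖ ^ 2 := by
    rw [Complex.conj_mul', ← Complex.ofReal_pow, Complex.ofReal_re]
  have e2 : (conj (u x) * ((q x : ℂ) * u x)).re = q x * ‖u x‖ ^ 2 := by
    have : conj (u x) * ((q x : ℂ) * u x) = (q x : ℂ) * (conj (u x) * u x) := by ring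
    rw [this, Complex.conj_mul', ← Complex.ofReal_pow, ← Complex.ofReal_mul, Complex.ofReal_re]
  rw [e1, e2]
  ring

/-- **Convexity of `|u|²` in a classically forbidden region**: if `u″ = q u` with `q ≥ 0`
pointwise on `[α, β]`, then `x ↦ |u(x)|²` is convex on `[α, β]`. [folklore] -/
theorem convexOn_norm_sq_of_nonneg {u u' : ℝ → ℂ} {q : ℝ → ℝ} {α β : ℝ}
    (h : ∀ x ∈ Icc α β, HasDerivAt u (u' x) x ∧ HasDerivAt u' ((q x : ℂ) * u x) x)
    (hq : ∀ x ∈ Icc α β, 0 ≤ q x) : ConvexOn ℝ (Icc α β) (fun y => ‖u y‖ ^ 2) := by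
  have h1 : ∀ x ∈ Icc α β, HasDerivAt (fun y => ‖u y‖ ^ 2) (2 * (conj (u x) * u' x).re) x :=
    fun x hx => hasDerivAt_norm_sq_complex (h x hx).1
  have h2 : ∀ x ∈ Icc α β, HasDerivAt (fun y => 2 * (conj (u y) * u' y).re)
      (2 * ‖u' x‖ ^ 2 + 2 * q x * ‖u x‖ ^ 2) x :=
    fun x hx => hasDerivAt_two_re_conj_mul (h x hx).1 (h x hx).2
  refine convexOn_of_hasDerivWithinAt2_nonneg (convex_Icc α β)
    (f' := fun x => 2 * (conj (u x) * u' x).re)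
    (f'' := fun x => 2 * ‖u' x‖ ^ 2 + 2 * q x * ‖u x‖ ^ 2)
    (fun x hx => (h1 x hx).continuousAt.continuousWithinAt)
    (fun x hx => (h1 x (interior_subset hx)).hasDerivWithinAt)
    (fun x hx => (h2 x (interior_subset hx)).hasDerivWithinAt) ?_
  intro x hx
  have := hq x (interior_subset hx)
  positivity

/-- **No concentration inside a barrier**: if `u″ = q u` with `q ≥ 0` on `[α, β]`, then
`|u(x)|² ≤ max(|u(α)|², |u(β)|²)` for every `x ∈ [α, β]`. [folklore] -/
theorem norm_sq_le_max_of_nonneg {u u' : ℝ → ℂ} {q : ℝ → ℝ} {α β x : ℝ}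
    (h : ∀ x ∈ Icc α β, HasDerivAt u (u' x) x ∧ HasDerivAt u' ((q x : ℂ) * u x) x)
    (hq : ∀ x ∈ Icc α β, 0 ≤ q x) (hx : x ∈ Icc α β) :
    ‖u x‖ ^ 2 ≤ max (‖u α‖ ^ 2) (‖u β‖ ^ 2) := by
  have hαβ : α ≤ β := hx.1.trans hx.2
  exact (convexOn_norm_sq_of_nonneg h hq).le_max_of_mem_Icc (left_mem_Icc.2 hαβ)
    (right_mem_Icc.2 hαβ) hx

/-- **Growth into a barrier**: if `u″ = q u` with `q ≥ 0` on `[α, β]` and `Re(ū u′)(α) ≥ 0` (the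
modulus is not decreasing at the left end), then `|u|²` is non-decreasing on `[α, β]`. [folklore] -/
theorem monotoneOn_norm_sq_of_nonneg {u u' : ℝ → ℂ} {q : ℝ → ℝ} {α β : ℝ}
    (h : ∀ x ∈ Icc α β, HasDerivAt u (u' x) x ∧ HasDerivAt u' ((q x : ℂ) * u x) x)
    (hq : ∀ x ∈ Icc α β, 0 ≤ q x) (hα : 0 ≤ (conj (u α) * u' α).re) :
    MonotoneOn (fun y => ‖u y‖ ^ 2) (Icc α β) := by
  have h1 : ∀ x ∈ Icc α β, HasDerivAt (fun y => ‖u y‖ ^ 2) (2 * (conj (u x) * u' x).re) x :=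
    fun x hx => hasDerivAt_norm_sq_complex (h x hx).1
  have h2 : ∀ x ∈ Icc α β, HasDerivAt (fun y => 2 * (conj (u y) * u' y).re)
      (2 * ‖u' x‖ ^ 2 + 2 * q x * ‖u x‖ ^ 2) x :=
    fun x hx => hasDerivAt_two_re_conj_mul (h x hx).1 (h x hx).2
  -- the first derivative `g = 2 Re(ū u′)` is non-decreasing, hence `≥ g(α) ≥ 0`
  have hg : MonotoneOn (fun y => 2 * (conj (u y) * u' y).re) (Icc α β) := by
    refine monotoneOn_of_deriv_nonneg (convex_Icc α β)
      (fun x hx => (h2 x hx).continuousAt.continuousWithinAt)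
      (fun x hx => (h2 x (interior_subset hx)).differentiableAt.differentiableWithinAt) ?_
    intro x hx
    rw [(h2 x (interior_subset hx)).deriv]
    have := hq x (interior_subset hx)
    positivity
  refine monotoneOn_of_deriv_nonneg (convex_Icc α β)
    (fun x hx => (h1 x hx).continuousAt.continuousWithinAt)
    (fun x hx => (h1 x (interior_subset hx)).differentiableAt.differentiableWithinAt) ?_
  intro x hx
  have hx' : x ∈ Icc α β := interior_subset hx
  rw [(h1 x hx').deriv]
  have hαmem : α ∈ Icc α β := left_mem_Icc.2 (hx'.1.trans hx'.2)
  have := hg hαmem hx' hx'.1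
  have h0 : 0 ≤ 2 * (conj (u α) * u' α).re := by positivity
  linarith

end Literature.Analysis.ODE

end
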